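import Mathlib
import HarnessLib
import Literature.MathematicalPhysics.QuantumLattice.FinDimSpectrumProofs
import Literature.MathematicalPhysics.QuantumLattice.GroundStateSourceBounds
import Summits.HubbardSuperconductivity.HubbardSuperconductivity.Theorems.WeakCouplingBCSWcbcsBcsConstructionLroSeedAbstract

/-!
# Crux `CwChiralConstruction` (stmt-HubbardSuperconductivity-1740), line `susceptibility-rise-budget`:
# stub `stub_budgetOfSlope`

Integration of the local slope estimate to the gap×variance transport budget. Granted the local
Hellmann–Feynman slope estimate (hypothesis `(S)`, literally the statement of the neighbour stub
`stub_slopeOfEnergyBounds`: for Hermitian `K, O, Y` with `K.HasSpectralGap γ` and `ε > 0`,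
`|Re ω_{K-τY}(O) - Re ω_K(O)| ≤ (2√(Var O · Var Y)/γ + ε)|τ|` for small `τ`), along the segment
`t ↦ K - tY`, `t ∈ [t₁, t₂] ⊂ (0, ∞)`, with gap `c t^a`, variances `≤ V t^{-b}` and `a + b < 1`:
`|Re ω_{t₂}(O) - Re ω_{t₁}(O)| ≤ 2V/(c(1-(a+b))) · (t₂^{1-(a+b)} - t₁^{1-(a+b)})`.

Proof (namespace `CwBudget`). Pure real analysis: a function `f : ℝ → ℝ` with the local (Dini)
estimate `|f z - f x| ≤ (D x + ε)|z - x|` near every `x ∈ [t₁, t₂]` (every `ε > 0`) is continuous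
there and its lower right Dini derivative is `≤ D x`, so Mathlib's ODE-comparison ("fencing") lemma
`image_le_of_liminf_slope_right_le_deriv_boundary` with the boundary function `f t₁ + P x - P t₁`,
`P' = D`, gives `f t₂ - f t₁ ≤ P t₂ - P t₁`; the same for `-f`. Here
`f t = Re ω_{K-tY}(O)`, `D t = (2V/c) t^{-(a+b)}` (from `(S)` at the base point `K - tY`, the
variances being nonnegative by positivity of the tracial ground state — the sibling crux's landed
`WcbcsLroSeed.re_sq_le_re_order_sq` — and `≤ V t^{-b}`), and `P t = 2V/(c(1-(a+b))) t^{1-(a+b)}`.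
Folklore (Kato, *Perturbation theory for linear operators*, §II.6; Walter, *Differential and
integral inequalities*, §I); no definitions, no named facts.
-/

set_option linter.dupNamespace false -- the summit namespace repeats `HubbardSuperconductivity`

namespace Summit.HubbardSuperconductivity.HubbardSuperconductivity.Theorems

open Literature.MathematicalPhysics.QuantumLattice Matrix Filter Set
open scoped Matrix.Norms.L2Operator ComplexOrder Topology

namespace CwBudget

/-! ### Real analysis: a local slope estimate integrates to a budget -/

/-- A function with the local estimate `|f z - f x| ≤ (D + ε)|z - x|` near `x` (for every `ε > 0`)
is continuous at `x`. [folklore] -/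
theorem continuousAt_of_local_slope {f : ℝ → ℝ} {x D : ℝ}
    (hf : ∀ ε > 0, ∃ δ > 0, ∀ z, |z - x| < δ → |f z - f x| ≤ (D + ε) * |z - x|) :
    ContinuousAt f x := by
  obtain ⟨δ, hδ, h⟩ := hf 1 one_pos
  rw [Metric.continuousAt_iff]
  intro ε hε
  have hL : 0 < |D| + 1 := by positivity
  refine ⟨min δ (ε / (|D| + 1)), lt_min hδ (div_pos hε hL), ?_⟩
  intro z hz
  rw [Real.dist_eq] at hz ⊢
  have hzδ : |z - x| < δ := lt_of_lt_of_le hz (min_le_left _ _)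
  have hzε : |z - x| < ε / (|D| + 1) := lt_of_lt_of_le hz (min_le_right _ _)
  calc |f z - f x| ≤ (D + 1) * |z - x| := h z hzδ
    _ ≤ (|D| + 1) * |z - x| :=
        mul_le_mul_of_nonneg_right (add_le_add_left (le_abs_self D) 1) (abs_nonneg _)
    _ < (|D| + 1) * (ε / (|D| + 1)) := mul_lt_mul_of_pos_left hzε hL
    _ = ε := mul_div_cancel₀ ε hL.ne'

/-- A function with the local estimate `|f z - f x| ≤ (D + ε)|z - x|` near `x` (for every `ε > 0`)
has lower right Dini derivative `≤ D` at `x`: for every `r > D`, frequently (indeed eventually) as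
`z → x⁺`, `slope f x z < r`. [folklore] -/
theorem frequently_slope_lt_of_local_slope {f : ℝ → ℝ} {x D r : ℝ}
    (hf : ∀ ε > 0, ∃ δ > 0, ∀ z, |z - x| < δ → |f z - f x| ≤ (D + ε) * |z - x|) (hr : D < r) :
    ∃ᶠ z in 𝓝[>] x, slope f x z < r := by
  obtain ⟨δ, hδ, h⟩ := hf ((r - D) / 2) (by linarith only [hr])
  refine Filter.Eventually.frequently ?_
  filter_upwards [Ioo_mem_nhdsGT (show x < x + δ by linarith only [hδ])] with z hz
  have hz0 : 0 < z - x := sub_pos.2 hz.1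
  have hzδ : |z - x| < δ := by
    rw [abs_of_pos hz0]
    linarith only [hz.2]
  have hb := h z hzδ
  rw [abs_of_pos hz0] at hb
  rw [slope_def_field, div_lt_iff₀ hz0]
  calc f z - f x ≤ |f z - f x| := le_abs_self _
    _ ≤ (D + (r - D) / 2) * (z - x) := hb
    _ < r * (z - x) := mul_lt_mul_of_pos_right (by linarith only [hr]) hz0

/-- **One-sided budget from a local slope estimate.** If `P' = D` on `[t₁, t₂]` and `f` obeys the
local estimate `|f z - f x| ≤ (D x + ε)|z - x|` near every `x ∈ [t₁, t₂]` (every `ε > 0`), then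
`f t₂ - f t₁ ≤ P t₂ - P t₁` (fencing lemma `image_le_of_liminf_slope_right_le_deriv_boundary` with
the boundary function `f t₁ + P x - P t₁`). [folklore] -/
theorem sub_le_of_local_slope {f D P : ℝ → ℝ} {t₁ t₂ : ℝ} (h12 : t₁ ≤ t₂)
    (hP : ∀ x ∈ Icc t₁ t₂, HasDerivAt P (D x) x)
    (hf : ∀ x ∈ Icc t₁ t₂, ∀ ε > 0, ∃ δ > 0, ∀ z, |z - x| < δ →
      |f z - f x| ≤ (D x + ε) * |z - x|) :
    f t₂ - f t₁ ≤ P t₂ - P t₁ := by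
  have hfc : ContinuousOn f (Icc t₁ t₂) := fun x hx =>
    (continuousAt_of_local_slope (hf x hx)).continuousWithinAt
  have hPc : ContinuousOn P (Icc t₁ t₂) := fun x hx => (hP x hx).continuousAt.continuousWithinAt
  have key := image_le_of_liminf_slope_right_le_deriv_boundary hfc
    (B := fun x => f t₁ + (P x - P t₁)) (B' := D) (by simp)
    (continuousOn_const.add (hPc.sub continuousOn_const))
    (fun x hx => (((hP x (Ico_subset_Icc_self hx)).sub_const (P t₁)).const_add
      (f t₁)).hasDerivWithinAt)
    (fun x hx _ hr => frequently_slope_lt_of_local_slope (hf x (Ico_subset_Icc_self hx)) hr)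
    (right_mem_Icc.2 h12)
  linarith only [key]

/-- **Two-sided budget from a local slope estimate.** If `P' = D` on `[t₁, t₂]` and `f` obeys the
local estimate `|f z - f x| ≤ (D x + ε)|z - x|` near every `x ∈ [t₁, t₂]` (every `ε > 0`), then
`|f t₂ - f t₁| ≤ P t₂ - P t₁` (the one-sided budget for `f` and for `-f`). [folklore] -/
theorem abs_sub_le_of_local_slope {f D P : ℝ → ℝ} {t₁ t₂ : ℝ} (h12 : t₁ ≤ t₂)
    (hP : ∀ x ∈ Icc t₁ t₂, HasDerivAt P (D x) x)
    (hf : ∀ x ∈ Icc t₁ t₂, ∀ ε > 0, ∃ δ > 0, ∀ z, |z - x| < δ →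
      |f z - f x| ≤ (D x + ε) * |z - x|) :
    |f t₂ - f t₁| ≤ P t₂ - P t₁ := by
  have h1 := sub_le_of_local_slope h12 hP hf
  have h2 := sub_le_of_local_slope (f := fun s => -f s) h12 hP (fun x hx ε hε => by
    obtain ⟨δ, hδ, h⟩ := hf x hx ε hε
    refine ⟨δ, hδ, fun z hz => ?_⟩
    show |-f z - -f x| ≤ (D x + ε) * |z - x|
    rw [neg_sub_neg, abs_sub_comm]
    exact h z hz)
  have h2' : -f t₂ - -f t₁ ≤ P t₂ - P t₁ := h2
  rw [abs_le]
  constructor <;> linarith only [h1, h2']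

end CwBudget

open CwBudget in
/-- **Stub `stub_budgetOfSlope`** (integration of the slope estimate). Granted the local slope
estimate (hypothesis, verbatim the statement of `stub_slopeOfEnergyBounds`) at every point of a
segment `t ∈ [t₁, t₂] ⊂ (0, ∞)` along `K - tY` (gap `c t^a`, variances `≤ V t^{-b}`, `a + b < 1`),
the sourced one-point function `f t = Re ω_{K-tY}(O)` is continuous on the segment and `±f` have
lower right Dini derivatives `≤ (2V/c) t^{-(a+b)}` there, whence
`|Re ω_{t₂}(O) - Re ω_{t₁}(O)| ≤ 2V/(c(1-(a+b)))·(t₂^{1-(a+b)} - t₁^{1-(a+b)})`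
(`CwBudget.abs_sub_le_of_local_slope`, Mathlib `image_le_of_liminf_slope_right_le_deriv_boundary`).
[folklore] -/
theorem stub_budgetOfSlope :
    (∀ {n : Type} [Fintype n] [DecidableEq n] [Nonempty n] (K O Y : Matrix n n ℂ), K.IsHermitian → O.IsHermitian → Y.IsHermitian → ∀ (γ : ℝ), 0 < γ → K.HasSpectralGap γ → ∀ ε : ℝ, 0 < ε → ∃ τ₀ : ℝ, 0 < τ₀ ∧ ∀ τ : ℝ, |τ| < τ₀ → |((K - (τ : ℂ) • Y).groundStateFunctional O).re - (K.groundStateFunctional O).re| ≤ (2 * Real.sqrt ((((K.groundStateFunctional (O * O)).re - (K.groundStateFunctional O).re ^ 2)) * ((K.groundStateFunctional (Y * Y)).re - (K.groundStateFunctional Y).re ^ 2)) / γ + ε) * |τ|) →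
    ∀ {n : Type} [Fintype n] [DecidableEq n] [Nonempty n] (K O Y : Matrix n n ℂ), K.IsHermitian → O.IsHermitian → Y.IsHermitian → ∀ (c V a b t₁ t₂ : ℝ), 0 < c → 0 ≤ V → a + b < 1 → 0 < t₁ → t₁ ≤ t₂ → (∀ t ∈ Set.Icc t₁ t₂, (K - (t : ℂ) • Y).HasSpectralGap (c * t ^ a)) → (∀ t ∈ Set.Icc t₁ t₂, ((K - (t : ℂ) • Y).groundStateFunctional (O * O)).re - ((K - (t : ℂ) • Y).groundStateFunctional O).re ^ 2 ≤ V * t ^ (-b)) → (∀ t ∈ Set.Icc t₁ t₂, ((K - (t : ℂ) • Y).groundStateFunctional (Y * Y)).re - ((K - (t : ℂ) • Y).groundStateFunctional Y).re ^ 2 ≤ V * t ^ (-b)) → |((K - (t₂ : ℂ) • Y).groundStateFunctional O).re - ((K - (t₁ : ℂ) • Y).groundStateFunctional O).re| ≤ 2 * V / (c * (1 - (a + b))) * (t₂ ^ (1 - (a + b)) - t₁ ^ (1 - (a + b))) := by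
  intro hS n _ _ _ K O Y hK hO hY c V a b t₁ t₂ hc hV hab ht₁ h12 hgap hVO hVY
  -- the sourced one-point function along the segment
  obtain ⟨f, hf⟩ : ∃ f : ℝ → ℝ, ∀ s, f s = ((K - (s : ℂ) • Y).groundStateFunctional O).re :=
    ⟨_, fun _ => rfl⟩
  rw [← hf t₂, ← hf t₁]
  have hp : 0 < 1 - (a + b) := sub_pos.2 hab
  have key := abs_sub_le_of_local_slope (f := f) (D := fun s => 2 * V / c * s ^ (-(a + b)))
    (P := fun s => 2 * V / (c * (1 - (a + b))) * s ^ (1 - (a + b))) h12 ?_ ?_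
  · refine key.trans_eq ?_
    ring
  · -- `P' = D` on `[t₁, t₂] ⊂ (0, ∞)`
    intro x hx
    have hx0 : 0 < x := ht₁.trans_le hx.1
    refine ((Real.hasDerivAt_rpow_const (p := 1 - (a + b)) (Or.inl hx0.ne')).const_mul
      (2 * V / (c * (1 - (a + b))))).congr_deriv ?_
    rw [show 1 - (a + b) - 1 = -(a + b) by ring]
    field_simp
  · -- the local slope estimate at the base point `K - tY`
    intro t ht ε hε
    have ht0 : 0 < t := ht₁.trans_le ht.1
    have hKt : (K - (t : ℂ) • Y).IsHermitian := isHermitian_sub_real_smul hK hY t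
    have hγ : 0 < c * t ^ a := mul_pos hc (Real.rpow_pos_of_pos ht0 a)
    obtain ⟨τ₀, hτ₀, hτ⟩ := hS (K - (t : ℂ) • Y) O Y hKt hO hY (c * t ^ a) hγ (hgap t ht) ε hε
    refine ⟨τ₀, hτ₀, fun z hz => ?_⟩
    have h := hτ (z - t) hz
    have e : K - (t : ℂ) • Y - ((z - t : ℝ) : ℂ) • Y = K - (z : ℂ) • Y := by
      rw [Complex.ofReal_sub, sub_smul, sub_sub_sub_cancel_right]
    rw [e] at h
    rw [hf z, hf t]
    refine h.trans (mul_le_mul_of_nonneg_right (add_le_add_left ?_ ε) (abs_nonneg _))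
    show _ ≤ 2 * V / c * t ^ (-(a + b))
    -- the variances at the base point are in `[0, V t^{-b}]`
    have hVt : 0 ≤ V * t ^ (-b) := mul_nonneg hV (Real.rpow_nonneg ht0.le _)
    have hO0 : 0 ≤ ((K - (t : ℂ) • Y).groundStateFunctional (O * O)).re -
        ((K - (t : ℂ) • Y).groundStateFunctional O).re ^ 2 :=
      sub_nonneg.2 (WcbcsLroSeed.re_sq_le_re_order_sq hKt hO)
    have hY0 : 0 ≤ ((K - (t : ℂ) • Y).groundStateFunctional (Y * Y)).re -
        ((K - (t : ℂ) • Y).groundStateFunctional Y).re ^ 2 :=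
      sub_nonneg.2 (WcbcsLroSeed.re_sq_le_re_order_sq hKt hY)
    have hs : Real.sqrt ((((K - (t : ℂ) • Y).groundStateFunctional (O * O)).re -
        ((K - (t : ℂ) • Y).groundStateFunctional O).re ^ 2) *
          (((K - (t : ℂ) • Y).groundStateFunctional (Y * Y)).re -
            ((K - (t : ℂ) • Y).groundStateFunctional Y).re ^ 2)) ≤ V * t ^ (-b) :=
      calc _ ≤ Real.sqrt ((V * t ^ (-b)) * (V * t ^ (-b))) :=
            Real.sqrt_le_sqrt (mul_le_mul (hVO t ht) (hVY t ht) hY0 hVt)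
        _ = V * t ^ (-b) := Real.sqrt_mul_self hVt
    have hst : t ^ (-(a + b)) = t ^ (-b) / t ^ a := by
      rw [← Real.rpow_sub ht0]
      congr 1
      ring
    calc _ ≤ 2 * (V * t ^ (-b)) / (c * t ^ a) :=
          div_le_div_of_nonneg_right (mul_le_mul_of_nonneg_left hs zero_le_two) hγ.le
      _ = 2 * V / c * t ^ (-(a + b)) := by
          rw [hst]
          ring

end Summit.HubbardSuperconductivity.HubbardSuperconductivity.Theorems
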